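import Literature.NumberTheory.Irrationality.Zudilin2014.SecondTaleArithmetic
import Summits.KontsevichZagierPeriods.Zeta5Search.Denom.TwoTaleP15TopWindow

/-!
# P15 partner: `Prop3T` holds — `D₂₂ₙ D₂₆ₙ · p̂_n ∈ ℤ` (printed [Zudilin2014ZetaTwo, Prop. 3])

Cell pub-zeta5, fam-denom (HONEST FRAMING: systematic search; no irrationality claim unless certified).

`Prop3T` of `Denom/TwoTaleP15TopWindow` is [Zudilin2014ZetaTwo, Proposition 3] (second inclusion,
`D_{ĉ₁} D_{ĉ₂} p̂ ∈ ℤ`) at the Whipple-partner parameters of P15,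
`â = (32n+2; 11n+1, 13n+1, 15n+1)`, `b̂ = (15n+2; 6n+1, 24n+2, 26n+2)`, where
`ĉ₁ = max{â₀−b̂₀, â₁−b̂₁, b̂₃*−â₂−1, b̂₃*−â₃−1, 2b̂₂*−â₀*−2} = max{17n, 5n, 13n, 11n, 22n} = 22n` and
`ĉ₂ = 2b̂₃*−â₀*−2 = 26n`.  It is now PROVED in the tree from the general Literature theorem
`exists_int_lcm_mul_formPT` (`Zudilin2014/SecondTaleArithmetic`, eq. (T3) + Prop. 3 for every admissible
parameter set); this discharges the hypothesis `h3 : Prop3T` of `integralTFlat_of_prop3T_topWindowT` and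
`zetaTwo_exponent_le_of_topWindowT` (which remain CONDITIONAL on `DecayT` and `TopWindowT`).
Nothing here concerns `ζ(5)`.
-/

namespace Summit.KontsevichZagierPeriods.Zeta5Search.Denom.TwoTaleP15Prop3

open Literature.NumberTheory.Irrationality.Zudilin2014
open Summit.KontsevichZagierPeriods.Zeta5Search.TwoTaleP15
open Summit.KontsevichZagierPeriods.Zeta5Search.Denom.TwoTaleP15TopWindow (Prop3T)

/-- The six parameter bounds of [Zudilin2014ZetaTwo, Prop. 3] at the P15 partner: `ĉ₁ = 22n`, `ĉ₂ = 26n`. -/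
theorem bounds (n : ℕ) :
    (aT n 0 - bT n 0).toNat ≤ 22 * n ∧ (aT n 1 - bT n 1).toNat ≤ 22 * n ∧
    (bMax (bT n) - aT n 2 - 1).toNat ≤ 22 * n ∧ (bMax (bT n) - aT n 3 - 1).toNat ≤ 22 * n ∧
    (2 * bMin (bT n) - a0star (aT n) - 2).toNat ≤ 22 * n ∧
    (2 * bMax (bT n) - a0star (aT n) - 2).toNat ≤ 26 * n := by
  simp only [bMax, bMin, a0star, aMid, aT_zero, aT_one, aT_two, aT_three, bT_zero, bT_one, bT_two,
    bT_three]
  omega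

/-- **`Prop3T` holds**: `D₂₂ₙ D₂₆ₙ · p̂(âₙ, b̂ₙ) ∈ ℤ` for every `n ≥ 1` — [Zudilin2014ZetaTwo, Proposition 3]
at the P15 partner parameters (PROVED, from `exists_int_lcm_mul_formPT`). -/
theorem prop3T_holds : Prop3T := by
  intro n hn
  obtain ⟨h0, h1, h2, h3, h4, h5⟩ := bounds n
  exact exists_int_lcm_mul_formPT (admissibleT hn) h0 h1 h2 h3 h4 h5

end Summit.KontsevichZagierPeriods.Zeta5Search.Denom.TwoTaleP15Prop3
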